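import Summits.HodgeConjecture.HodgeConjecture.Theorems.Ring2SemiregularRepresentativesLef
import HarnessLib

/-!
# Road b02 (`VHCAbelianSchemesRoad`, D-0059) — the door-generic REGIME VOCABULARY of the registered skeletons, importable

research route conditional on HC_CM; not a corollary; Q11.4-sentence-2 already refuted in dim ≥ 3.

DEFINITIONS ONLY (nothing asserted, nothing proved, `HC_CM` absent). The two registered crux skeletons of the road —
`Cruxes/SemiregularSheafRepresentativesLefAt/Lines/birth.lean` (item stmt-HodgeConjecture-19779, namespace `…BirthV22`, ring2 LEAD
gen 145) and its TWIN over the twisted door `Cruxes/SemiregularSheafRepresentativesTwAt/Lines/birth.lean` (crux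
stmt-HodgeConjecture-19274, namespace `…BirthTw`, ring2 LEAD gen 146) — split K-SR♭∃ `AdmissibleRepresentativesLefAt 𝒪` on the
class `W` into a LEFSCHETZ regime (`W` algebraic-Lefschetz on every fibre) and an EXCEPTIONAL regime (not so), plus the BC5
plan-only rung (the exceptional regime for sixfold pencils in middle codimension). Both skeletons REPEAT the three regime predicates
verbatim «because crux workfiles are not importable on the farm». This file lands them ONCE, BYTE-IDENTICAL bodies, in the carrier's
namespace `Ring2.SemiregularRepresentatives` (next to `AdmissibleRepresentativesLefAt`, p408365), so that (i) stub proofs under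
`Theorems/` can state the registered stub signatures `∀ C, LefAtLefschetzRegime (…)` literally, and (ii) the lead may re-point either
skeleton at these constants by a one-line `open` (the local copies unfold to the same terms).

* `LefAtLefschetzRegime 𝒪` — regime 1: the binders of `AdmissibleRepresentativesLefAt 𝒪` plus the hypothesis that `W` is an algebraic
  LEFSCHETZ class (`divisorClassesSpan`) on EVERY fibre; PROVED for every door with null data (`HasNullDatum 𝒪`, e.g. `bfSheafClass C`
  and `twistedReflexiveClass C AdmTw`) in the companion files `…StubLefschetzRegime(Tw).lean`; stated as a predicate on doors, hence tagged
  `@[conjecture]` like its parent (a door WITHOUT null data need not satisfy it).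
* `LefAtExceptionalRegime 𝒪` — regime 2: the same binders plus the NEGATION of that hypothesis (on abelian fibres: `W` EXCEPTIONAL on some
  fibre, van Geemen 1994 §2.4); the research content of the road (open).
* `LefAtExceptionalRegimeSixfoldMiddle 𝒪` — regime 2 at `n = 6`, `p = 3` (BC5 plan-only rung; open; its split-Weil sub-case is
  citation-expected from Markman's μ-twisted secant sheaves on SPLIT Weil-type sixfold pencils, arXiv:2502.03415 Thm 1.5.1, PREPRINT; the
  non-split sub-case is open in print).
* §2 (appended, ab-andre-2 gen 54): the same two statements GRADED by `(n, p)` — `AdmissibleRepresentativesLefAtDeg 𝒪 n p`,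
  `LefAtExceptionalRegimeAt 𝒪 n p` (binders promoted to parameters, nothing else changed) — for the degree confinement of the companion
  file `VHCAbelianSchemesRoadDegreeConfinement.lean` (regime 2 is void off `2 ≤ p ≤ n − 2`).

References: [cite: Bloch1972Semiregularity, Remark (7.5)] [cite: BuchweitzFlenner2003, §5 Thm. 5.1 and Def. 4.10]
[cite: vanGeemen1994HodgeAV, §2.4 and Thm. 4.11] [cite: Markman2025SecantWeil, Thm. 1.5.1].
-/

noncomputable section

open CategoryTheory CategoryTheory.Limits AlgebraicGeometry Topology

namespace Summit.HodgeConjecture.HodgeConjecture.Ring2.SemiregularRepresentatives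

-- the cell's namespace repeats the summit name (`Summit.HodgeConjecture.HodgeConjecture…`), as in every `Ring2*` file
set_option linter.dupNamespace false

open Literature.AlgebraicGeometry Literature.AlgebraicGeometry.Motives
open Literature.AlgebraicGeometry.HodgeTheory
open Literature.AlgebraicTopology.SingularHomology
open Literature.Barriers.HodgeConjecture (divisorClassesSpan)
open Summit.Ventures.HSemireg (ObjClass)

/-- **Regime 1 of K-SR♭∃ for the door `𝒪` (`LefAtLefschetzRegime 𝒪`)**: the binders of `AdmissibleRepresentativesLefAt 𝒪`
(one-parameter abelian scheme `f : 𝒳 → S` over a smooth irreducible affine curve with a section; a fibrewise rational `(p,p)`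
global class `W`, algebraic at `s₀`) PLUS the regime hypothesis «`W` is an algebraic LEFSCHETZ class (`divisorClassesSpan`) on EVERY
fibre»; conclusion = that of `AdmissibleRepresentativesLefAt 𝒪` (an `𝒪`-admissible datum at SOME fibre with `κ_p = a·W| + Z|`,
`a ≠ 0`, `Z` fibrewise algebraic-Lefschetz). VERBATIM the predicate of both registered skeletons (`…BirthV22.LefAtLefschetzRegime`,
`…BirthTw.LefAtLefschetzRegime`). Holds for every door with null data (the null datum, `Z := −W`): companion stub files. A
predicate on doors — a HYPOTHESIS wherever used for a general `𝒪`. [cite: vanGeemen1994HodgeAV, §2.4]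
[cite: Bloch1972Semiregularity, Remark (7.5)] -/
@[conjecture] def LefAtLefschetzRegime (𝒪 : ObjClass) : Prop :=
  ∀ ⦃n : ℕ⦄ ⦃𝒳 S : SchemeOver ℂ⦄ (f : 𝒳 ⟶ S), IsSmoothProjectiveFamily f n → IsQuasiProjectiveOver 𝒳 →
    IrreducibleSpace S.left → IsAffine S.left → AlgebraicGeometry.Smooth S.hom → topologicalKrullDim S.left = 1 →
    (∀ s : ComplexPoints S, ∃ A' : AbelianVariety ℂ, A'.dim = n ∧ Nonempty (A'.X ≅ fiberOver f s)) →
    (∃ e : S ⟶ 𝒳, e ≫ f = 𝟙 S) →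
    ∀ (p : ℕ) (W : complexBetti 𝒳 (2 * p)),
      (∀ s : ComplexPoints S, IsRationalClass (complexBetti.map (fiberι f s) (2 * p) W) ∧
        IsOfHodgeType n (fiberOver f s) (2 * p) p p (complexBetti.map (fiberι f s) (2 * p) W)) →
      ∀ s₀ : ComplexPoints S,
        complexBetti.map (fiberι f s₀) (2 * p) W ∈ algebraicClasses (fiberOver f s₀) p →
        (∀ s : ComplexPoints S,
          complexBetti.map (fiberι f s) (2 * p) W ∈ algebraicClasses (fiberOver f s) p ∧
          complexBetti.map (fiberι f s) (2 * p) W ∈ divisorClassesSpan (fiberOver f s) n p) →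
        ∃ (s₁ : ComplexPoints S) (I : Finset ℕ) (κ : (q : ℕ) → complexBetti (fiberOver f s₁) (2 * q))
          (V : (q : ℕ) → complexBetti 𝒳 (2 * q)) (a : ℂ) (Z : complexBetti 𝒳 (2 * p)),
          p ∈ I ∧ 𝒪 n (fiberOver f s₁) I κ ∧ a ≠ 0 ∧
          (∀ s : ComplexPoints S,
            complexBetti.map (fiberι f s) (2 * p) Z ∈ algebraicClasses (fiberOver f s) p ∧
            complexBetti.map (fiberι f s) (2 * p) Z ∈ divisorClassesSpan (fiberOver f s) n p) ∧
          V p = a • W + Z ∧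
          (∀ q ∈ I, κ q = complexBetti.map (fiberι f s₁) (2 * q) (V q)) ∧
          (∀ q ∈ I, ∀ s : ComplexPoints S,
            IsOfHodgeType n (fiberOver f s) (2 * q) q q (complexBetti.map (fiberι f s) (2 * q) (V q)))

/-- **Regime 2 of K-SR♭∃ for the door `𝒪` (`LefAtExceptionalRegime 𝒪`)**: the binders of `AdmissibleRepresentativesLefAt 𝒪` PLUS
the NEGATION of regime 1's hypothesis — `W` is NOT algebraic-Lefschetz on every fibre (on abelian fibres, by Lefschetz `(1,1)` and
van Geemen §2.4: `W` is EXCEPTIONAL on some fibre); same conclusion. THE RESEARCH CONTENT of the road: a semiregular (twisted) carrier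
with `κ_p = a·W| + (Lefschetz)` at some fibre of a pencil on which `W` is somewhere exceptional; in print only Markman's μ-twisted secant
sheaves on SPLIT Weil-type sixfold pencils (PREPRINT). VERBATIM the predicate of both registered skeletons. OPEN; a HYPOTHESIS wherever
used. [cite: vanGeemen1994HodgeAV, §2.4 and Thm. 4.11] [cite: Bloch1972Semiregularity, Remark (7.5)]
[cite: BuchweitzFlenner2003, §5 Thm. 5.1] [cite: Markman2025SecantWeil, Thm. 1.5.1] -/
@[conjecture] def LefAtExceptionalRegime (𝒪 : ObjClass) : Prop :=
  ∀ ⦃n : ℕ⦄ ⦃𝒳 S : SchemeOver ℂ⦄ (f : 𝒳 ⟶ S), IsSmoothProjectiveFamily f n → IsQuasiProjectiveOver 𝒳 →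
    IrreducibleSpace S.left → IsAffine S.left → AlgebraicGeometry.Smooth S.hom → topologicalKrullDim S.left = 1 →
    (∀ s : ComplexPoints S, ∃ A' : AbelianVariety ℂ, A'.dim = n ∧ Nonempty (A'.X ≅ fiberOver f s)) →
    (∃ e : S ⟶ 𝒳, e ≫ f = 𝟙 S) →
    ∀ (p : ℕ) (W : complexBetti 𝒳 (2 * p)),
      (∀ s : ComplexPoints S, IsRationalClass (complexBetti.map (fiberι f s) (2 * p) W) ∧
        IsOfHodgeType n (fiberOver f s) (2 * p) p p (complexBetti.map (fiberι f s) (2 * p) W)) →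
      ∀ s₀ : ComplexPoints S,
        complexBetti.map (fiberι f s₀) (2 * p) W ∈ algebraicClasses (fiberOver f s₀) p →
        (¬ ∀ s : ComplexPoints S,
          complexBetti.map (fiberι f s) (2 * p) W ∈ algebraicClasses (fiberOver f s) p ∧
          complexBetti.map (fiberι f s) (2 * p) W ∈ divisorClassesSpan (fiberOver f s) n p) →
        ∃ (s₁ : ComplexPoints S) (I : Finset ℕ) (κ : (q : ℕ) → complexBetti (fiberOver f s₁) (2 * q))
          (V : (q : ℕ) → complexBetti 𝒳 (2 * q)) (a : ℂ) (Z : complexBetti 𝒳 (2 * p)),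
          p ∈ I ∧ 𝒪 n (fiberOver f s₁) I κ ∧ a ≠ 0 ∧
          (∀ s : ComplexPoints S,
            complexBetti.map (fiberι f s) (2 * p) Z ∈ algebraicClasses (fiberOver f s) p ∧
            complexBetti.map (fiberι f s) (2 * p) Z ∈ divisorClassesSpan (fiberOver f s) n p) ∧
          V p = a • W + Z ∧
          (∀ q ∈ I, κ q = complexBetti.map (fiberι f s₁) (2 * q) (V q)) ∧
          (∀ q ∈ I, ∀ s : ComplexPoints S,
            IsOfHodgeType n (fiberOver f s) (2 * q) q q (complexBetti.map (fiberι f s) (2 * q) (V q)))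

/-- **The BC5 rung (`LefAtExceptionalRegimeSixfoldMiddle 𝒪`)**: regime 2 for abelian SIXFOLD pencils in middle codimension `p = 3` —
the first dimension outside the regime of record `Markman2025_hodgeClasses_algebraic_abelian_dim_le_five`; its split-Weil sub-case is
citation-expected (Markman's μ_{8d}-twisted semiregular secant carrier on split Weil-type sixfold pencils, PREPRINT), its NON-SPLIT
sub-case is open in print (the separating content). VERBATIM the predicate of both registered skeletons; a literal specialisation of
`LefAtExceptionalRegime 𝒪`. OPEN; a HYPOTHESIS wherever used. [cite: Markman2025SecantWeil, Thm. 1.4.1 and Thm. 1.5.1]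
[cite: vanGeemen1994HodgeAV, Thm. 4.11] -/
@[conjecture] def LefAtExceptionalRegimeSixfoldMiddle (𝒪 : ObjClass) : Prop :=
  ∀ ⦃𝒳 S : SchemeOver ℂ⦄ (f : 𝒳 ⟶ S), IsSmoothProjectiveFamily f 6 → IsQuasiProjectiveOver 𝒳 →
    IrreducibleSpace S.left → IsAffine S.left → AlgebraicGeometry.Smooth S.hom → topologicalKrullDim S.left = 1 →
    (∀ s : ComplexPoints S, ∃ A' : AbelianVariety ℂ, A'.dim = 6 ∧ Nonempty (A'.X ≅ fiberOver f s)) →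
    (∃ e : S ⟶ 𝒳, e ≫ f = 𝟙 S) →
    ∀ (W : complexBetti 𝒳 (2 * 3)),
      (∀ s : ComplexPoints S, IsRationalClass (complexBetti.map (fiberι f s) (2 * 3) W) ∧
        IsOfHodgeType 6 (fiberOver f s) (2 * 3) 3 3 (complexBetti.map (fiberι f s) (2 * 3) W)) →
      ∀ s₀ : ComplexPoints S,
        complexBetti.map (fiberι f s₀) (2 * 3) W ∈ algebraicClasses (fiberOver f s₀) 3 →
        (¬ ∀ s : ComplexPoints S,
          complexBetti.map (fiberι f s) (2 * 3) W ∈ algebraicClasses (fiberOver f s) 3 ∧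
          complexBetti.map (fiberι f s) (2 * 3) W ∈ divisorClassesSpan (fiberOver f s) 6 3) →
        ∃ (s₁ : ComplexPoints S) (I : Finset ℕ) (κ : (q : ℕ) → complexBetti (fiberOver f s₁) (2 * q))
          (V : (q : ℕ) → complexBetti 𝒳 (2 * q)) (a : ℂ) (Z : complexBetti 𝒳 (2 * 3)),
          3 ∈ I ∧ 𝒪 6 (fiberOver f s₁) I κ ∧ a ≠ 0 ∧
          (∀ s : ComplexPoints S,
            complexBetti.map (fiberι f s) (2 * 3) Z ∈ algebraicClasses (fiberOver f s) 3 ∧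
            complexBetti.map (fiberι f s) (2 * 3) Z ∈ divisorClassesSpan (fiberOver f s) 6 3) ∧
          V 3 = a • W + Z ∧
          (∀ q ∈ I, κ q = complexBetti.map (fiberι f s₁) (2 * q) (V q)) ∧
          (∀ q ∈ I, ∀ s : ComplexPoints S,
            IsOfHodgeType 6 (fiberOver f s) (2 * q) q q (complexBetti.map (fiberι f s) (2 * q) (V q)))

/-! ## §2 The regimes GRADED by relative dimension `n` and codimension `p` (ab-andre-2 gen 54, PART W)

The crux `AdmissibleRepresentativesLefAt 𝒪` and its exceptional regime quantify over ALL relative dimensions `n` and ALL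
codimensions `p` at once. The two predicates below fix `(n, p)` — bodies = the parent bodies with the binders `⦃n⦄` and `(p)`
promoted to parameters, NOTHING else changed — so that degree-by-degree statements can be made: the companion proof file
`VHCAbelianSchemesRoadDegreeConfinement.lean` shows the exceptional regime is VOID off the middle range `2 ≤ p ≤ n − 2` (Lefschetz
`(1,1)`, hard Lefschetz, `H⁰ = ℂ · 1` — tree theorems), so that the research content of the road lives in `LefAtExceptionalRegimeAt 𝒪 n p`
for `2 ≤ p`, `p + 2 ≤ n` only, first pair `(n, p) = (4, 2)`; and `LefAtExceptionalRegimeSixfoldMiddle 𝒪 ↔ LefAtExceptionalRegimeAt 𝒪 6 3`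
is `Iff.rfl`. -/

/-- **K-SR♭∃ for the door `𝒪` AT relative dimension `n` and codimension `p` (`AdmissibleRepresentativesLefAtDeg 𝒪 n p`)**: the body
of `AdmissibleRepresentativesLefAt 𝒪` (p408365) with the relative dimension `n` of the one-parameter abelian scheme and the
codimension `p` of the class `W` FIXED (binders promoted to parameters, nothing else changed); `AdmissibleRepresentativesLefAt 𝒪 ↔
∀ n p, AdmissibleRepresentativesLefAtDeg 𝒪 n p` (companion file). A predicate on doors and degrees — a HYPOTHESIS wherever used for
a general `𝒪`; for doors with null data it HOLDS off the middle range `2 ≤ p ≤ n − 2` (companion file).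
[cite: Bloch1972Semiregularity, Remark (7.5)] [cite: BuchweitzFlenner2003, §5 Thm. 5.1] [cite: vanGeemen1994HodgeAV, §2.4] -/
@[conjecture] def AdmissibleRepresentativesLefAtDeg (𝒪 : ObjClass) (n p : ℕ) : Prop :=
  ∀ ⦃𝒳 S : SchemeOver ℂ⦄ (f : 𝒳 ⟶ S), IsSmoothProjectiveFamily f n → IsQuasiProjectiveOver 𝒳 →
    IrreducibleSpace S.left → IsAffine S.left → AlgebraicGeometry.Smooth S.hom → topologicalKrullDim S.left = 1 →
    (∀ s : ComplexPoints S, ∃ A' : AbelianVariety ℂ, A'.dim = n ∧ Nonempty (A'.X ≅ fiberOver f s)) →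
    (∃ e : S ⟶ 𝒳, e ≫ f = 𝟙 S) →
    ∀ (W : complexBetti 𝒳 (2 * p)),
      (∀ s : ComplexPoints S, IsRationalClass (complexBetti.map (fiberι f s) (2 * p) W) ∧
        IsOfHodgeType n (fiberOver f s) (2 * p) p p (complexBetti.map (fiberι f s) (2 * p) W)) →
      ∀ s₀ : ComplexPoints S,
        complexBetti.map (fiberι f s₀) (2 * p) W ∈ algebraicClasses (fiberOver f s₀) p →
        ∃ (s₁ : ComplexPoints S) (I : Finset ℕ) (κ : (q : ℕ) → complexBetti (fiberOver f s₁) (2 * q))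
          (V : (q : ℕ) → complexBetti 𝒳 (2 * q)) (a : ℂ) (Z : complexBetti 𝒳 (2 * p)),
          p ∈ I ∧ 𝒪 n (fiberOver f s₁) I κ ∧ a ≠ 0 ∧
          (∀ s : ComplexPoints S,
            complexBetti.map (fiberι f s) (2 * p) Z ∈ algebraicClasses (fiberOver f s) p ∧
            complexBetti.map (fiberι f s) (2 * p) Z ∈ divisorClassesSpan (fiberOver f s) n p) ∧
          V p = a • W + Z ∧
          (∀ q ∈ I, κ q = complexBetti.map (fiberι f s₁) (2 * q) (V q)) ∧
          (∀ q ∈ I, ∀ s : ComplexPoints S,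
            IsOfHodgeType n (fiberOver f s) (2 * q) q q (complexBetti.map (fiberι f s) (2 * q) (V q)))

/-- **Regime 2 of K-SR♭∃ for the door `𝒪` AT relative dimension `n` and codimension `p` (`LefAtExceptionalRegimeAt 𝒪 n p`)**: the body
of `LefAtExceptionalRegime 𝒪` with `n` and `p` FIXED (binders promoted to parameters, nothing else changed):
on every one-parameter abelian scheme of relative dimension `n` over a smooth irreducible affine curve with a section, every fibrewise
rational `(p,p)` global class `W`, algebraic at `s₀` and NOT algebraic-Lefschetz on every fibre, has an `𝒪`-admissible datum with
`κ_p = a·W| + Z|` (`a ≠ 0`, `Z` fibrewise algebraic-Lefschetz) at SOME fibre. `LefAtExceptionalRegime 𝒪 ↔ ∀ n p,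
LefAtExceptionalRegimeAt 𝒪 n p` and `LefAtExceptionalRegimeSixfoldMiddle 𝒪 ↔ LefAtExceptionalRegimeAt 𝒪 6 3` (companion file, the
latter `Iff.rfl`). VOID — hence provable for every door — off the middle range `2 ≤ p ≤ n − 2` (companion file); OPEN there, first pair
`(4, 2)` (Weil-type abelian fourfolds carry exceptional `(2,2)`-classes, van Geemen Thm. 4.11); a HYPOTHESIS wherever used.
[cite: vanGeemen1994HodgeAV, §2.4 and Thm. 4.11] [cite: Bloch1972Semiregularity, Remark (7.5)] [cite: BuchweitzFlenner2003, §5 Thm. 5.1] -/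
@[conjecture] def LefAtExceptionalRegimeAt (𝒪 : ObjClass) (n p : ℕ) : Prop :=
  ∀ ⦃𝒳 S : SchemeOver ℂ⦄ (f : 𝒳 ⟶ S), IsSmoothProjectiveFamily f n → IsQuasiProjectiveOver 𝒳 →
    IrreducibleSpace S.left → IsAffine S.left → AlgebraicGeometry.Smooth S.hom → topologicalKrullDim S.left = 1 →
    (∀ s : ComplexPoints S, ∃ A' : AbelianVariety ℂ, A'.dim = n ∧ Nonempty (A'.X ≅ fiberOver f s)) →
    (∃ e : S ⟶ 𝒳, e ≫ f = 𝟙 S) →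
    ∀ (W : complexBetti 𝒳 (2 * p)),
      (∀ s : ComplexPoints S, IsRationalClass (complexBetti.map (fiberι f s) (2 * p) W) ∧
        IsOfHodgeType n (fiberOver f s) (2 * p) p p (complexBetti.map (fiberι f s) (2 * p) W)) →
      ∀ s₀ : ComplexPoints S,
        complexBetti.map (fiberι f s₀) (2 * p) W ∈ algebraicClasses (fiberOver f s₀) p →
        (¬ ∀ s : ComplexPoints S,
          complexBetti.map (fiberι f s) (2 * p) W ∈ algebraicClasses (fiberOver f s) p ∧
          complexBetti.map (fiberι f s) (2 * p) W ∈ divisorClassesSpan (fiberOver f s) n p) →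
        ∃ (s₁ : ComplexPoints S) (I : Finset ℕ) (κ : (q : ℕ) → complexBetti (fiberOver f s₁) (2 * q))
          (V : (q : ℕ) → complexBetti 𝒳 (2 * q)) (a : ℂ) (Z : complexBetti 𝒳 (2 * p)),
          p ∈ I ∧ 𝒪 n (fiberOver f s₁) I κ ∧ a ≠ 0 ∧
          (∀ s : ComplexPoints S,
            complexBetti.map (fiberι f s) (2 * p) Z ∈ algebraicClasses (fiberOver f s) p ∧
            complexBetti.map (fiberι f s) (2 * p) Z ∈ divisorClassesSpan (fiberOver f s) n p) ∧
          V p = a • W + Z ∧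
          (∀ q ∈ I, κ q = complexBetti.map (fiberι f s₁) (2 * q) (V q)) ∧
          (∀ q ∈ I, ∀ s : ComplexPoints S,
            IsOfHodgeType n (fiberOver f s) (2 * q) q q (complexBetti.map (fiberι f s) (2 * q) (V q)))

end Summit.HodgeConjecture.HodgeConjecture.Ring2.SemiregularRepresentatives

end
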